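import Literature.NumberTheory.DiophantineGeometry.ApproximationBoundRatPadicOfCoreProofs
import Literature.NumberTheory.DiophantineGeometry.ApproximationBoundRatPadicDependenceProofs
import HarnessLib

/-!
# The `p`-adic approximation bound over `ℚ` ("A1.L(p)") from the two Kummer-free `p`-adic cores
# in SHAPE form (odd `p` and `p = 2`)

Topic `NumberTheory/DiophantineGeometry`; namespace `Literature.NumberTheory.DiophantineGeometry.Dioph`.
Proofs only: no definition, no named fact. Last of the companion files
`ApproximationBoundRatPadic{Units,CaseA,OfCore,Dependence}Proofs`.

`padicApproximationBound_rat_of_padicCores (hOdd) (hTwo) : padicApproximationBound_rat` — the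
`p`-adic clause of Pasten 2024 Thm 2.1 (`d = 1`) with the constant existential (the cell
`abc-stewartyu`'s sub-rung "A1.L(p)", decl of `ApproximationBoundRat.lean`) follows from two
`p`-adic linear-forms bounds in shape form, taken as HYPOTHESES with their texts spelled out:
`hOdd` = "∃ c, for every odd prime `p`, every `r`, all multiplicatively independent rational
`p`-adic units `θᵢ` with weights `h(θᵢ) ≤ Aᵢ`, `1 ≤ Aᵢ ≤ Amax`, exponents `m ≠ 0`,
`log max(3,|mᵢ|) ≤ W`, `1 ≤ W`: `ord_p(∏ θᵢ^{mᵢ} − 1)·log p ≤ cʳ·(p/log p)·∏Aᵢ·(W + log p + log 2Amax)`"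
(Yu 2007, Main Theorem over `ℚ`, in the `cʳ` shape; = the text of the cell's internal statement
`CoreOdd` with the Kummer hypothesis deleted), `hTwo` = its `2`-adic twin for units `≡ 1 (mod 8)`
(`ord₂(∏ θᵢ^{mᵢ} − 1) ≤ cʳ·∏Aᵢ·(W + log 2Amax)`). Neither hypothesis is proved in the tree (they
are the planned crux texts `PadicCoreOddRat` / `PadicCoreTwoRat` of the cell's draft library rung);
this file is the SUPPORT chain "PadicShapeChain" of that plan: `Fin r`-reindexing to arbitrary index
types, the `p = 2` normalisation `ord₂ ≤ ord₂·(2/log 2)·…`, then `depCore_of_indepCore`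
(elimination of multiplicative relations) and `padicApproximationBound_rat_of_depCore`
(Evertse–Győry §4.4.2 at `α = 1`).

## References

* [Yu2007] K. Yu, *p-adic logarithmic forms and group varieties III*, Forum Math. 19 (2007) —
  Main Theorem (case `K = ℚ`), the source of the two shape hypotheses.
* [EvertseGyory2015] J.-H. Evertse, K. Győry, *Unit Equations in Diophantine Number Theory*,
  CUP 2015 — Thm 4.2.1 (p. 68), §4.4.2 (pp. 80–81).
* [Pasten2024] H. Pasten, Invent. Math. 236 (2024) — Theorem 2.1 (ii), `d = 1`.
-/

noncomputable section

open Finset Real Height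

namespace Literature.NumberTheory.DiophantineGeometry.Dioph

/-! ### `Fin r`-reindexing of the cores -/

/-- **The odd-`p` core on an arbitrary finite index type** (from its `Fin r` text, constant
`max 1 |c|`; reindexing along `Fintype.equivFin`). [cite: Yu2007, Main Theorem (K = ℚ)] -/
theorem indepCore_of_padicCoreOdd {c : ℝ}
    (hOdd : ∀ (p : ℕ), p.Prime → p ≠ 2 → ∀ (r : ℕ) (θ : Fin r → ℚ) (m : Fin r → ℤ)
      (A : Fin r → ℝ) (Amax W : ℝ),
      (∀ i, θ i ≠ 0 ∧ padicValRat p (θ i) = 0) → (∀ μ : Fin r → ℤ, ∏ i, θ i ^ μ i = 1 → μ = 0) →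
      (∀ i, Height.logHeight₁ (θ i) ≤ A i) → (∀ i, 1 ≤ A i) → (∀ i, A i ≤ Amax) →
      m ≠ 0 → (∀ i, Real.log (max 3 (|m i| : ℝ)) ≤ W) → 1 ≤ W →
      (padicValRat p (∏ i, θ i ^ m i - 1) : ℝ) * Real.log p ≤
        c ^ r * ((p : ℝ) / Real.log p) * (∏ i, A i) * (W + Real.log p + Real.log (2 * Amax)))
    {C₀ : ℝ} (hcC : max 1 |c| ≤ C₀) {p : ℕ} (hp : p.Prime) (hp2 : p ≠ 2)
    (κ : Type) [Fintype κ] [DecidableEq κ] (θ : κ → ℚ) (n : κ → ℤ) (A : κ → ℝ) (Amax W : ℝ)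
    (hθ : ∀ k, θ k ≠ 0 ∧ padicValRat p (θ k) = 0)
    (hind : ∀ μ : κ → ℤ, ∏ k, θ k ^ μ k = 1 → μ = 0)
    (hA : ∀ k, logHeight₁ (θ k) ≤ A k) (hA1 : ∀ k, 1 ≤ A k) (hAmax : ∀ k, A k ≤ Amax)
    (hn : n ≠ 0) (hW : ∀ k, Real.log (max 3 (|n k| : ℝ)) ≤ W) (hW1 : 1 ≤ W) :
    (padicValRat p (∏ k, θ k ^ n k - 1) : ℝ) * Real.log p ≤
      C₀ ^ Fintype.card κ * (p / Real.log p) * (∏ k, A k) *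
        (W + Real.log p + Real.log (2 * Amax)) := by
  set r := Fintype.card κ with hr
  set e : κ ≃ Fin r := Fintype.equivFin κ with he
  have hprod : ∀ (f : κ → ℤ), ∏ i : Fin r, θ (e.symm i) ^ f (e.symm i) = ∏ k, θ k ^ f k :=
    fun f => Fintype.prod_equiv e.symm _ _ fun i => rfl
  have hprodA : ∏ i : Fin r, A (e.symm i) = ∏ k, A k := Fintype.prod_equiv e.symm _ _ fun i => rfl
  have hind' : ∀ μ : Fin r → ℤ, ∏ i, θ (e.symm i) ^ μ i = 1 → μ = 0 := by
    intro μ hμ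
    have h1 : ∏ k, θ k ^ μ (e k) = 1 := by
      rw [← hprod (fun k => μ (e k))]
      simp only [Equiv.apply_symm_apply]
      exact hμ
    have h2 := hind (fun k => μ (e k)) h1
    funext i
    have := congrFun h2 (e.symm i)
    simpa using this
  have hn' : (fun i : Fin r => n (e.symm i)) ≠ 0 := by
    intro h0; apply hn; funext k
    have := congrFun h0 (e k)
    simpa using this
  have h := hOdd p hp hp2 r (fun i => θ (e.symm i)) (fun i => n (e.symm i)) (fun i => A (e.symm i))
    Amax W (fun i => hθ _) hind' (fun i => hA _) (fun i => hA1 _) (fun i => hAmax _) hn'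
    (fun i => hW _) hW1
  rw [hprod n, hprodA] at h
  -- `c^r ≤ (max 1 |c|)^r` on a non-negative quantity
  have hp1 : (1 : ℝ) < p := by exact_mod_cast hp.one_lt
  have hX : 0 ≤ (p : ℝ) / Real.log p * (∏ k, A k) * (W + Real.log p + Real.log (2 * Amax)) := by
    have h1 : 0 ≤ (p : ℝ) / Real.log p := div_nonneg (by linarith) (Real.log_pos hp1).le
    have h2 : 0 ≤ ∏ k, A k := Finset.prod_nonneg fun k _ => le_trans zero_le_one (hA1 k)
    have h3 : 0 ≤ W + Real.log p + Real.log (2 * Amax) := by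
      have hAmax1 : 1 ≤ Amax := by
        obtain ⟨k⟩ : Nonempty κ := by
          by_contra h0; rw [not_nonempty_iff] at h0; exact hn (funext fun k => isEmptyElim k)
        exact le_trans (hA1 k) (hAmax k)
      have : 0 ≤ Real.log (2 * Amax) := Real.log_nonneg (by linarith)
      have : 0 ≤ Real.log p := (Real.log_pos hp1).le
      linarith
    positivity
  have hcr : c ^ r ≤ C₀ ^ r :=
    le_trans (le_abs_self _) (by
      rw [abs_pow]; exact pow_le_pow_left₀ (abs_nonneg c) ((le_max_right _ _).trans hcC) r)
  calc (padicValRat p (∏ k, θ k ^ n k - 1) : ℝ) * Real.log p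
      ≤ c ^ r * (p / Real.log p) * (∏ k, A k) * (W + Real.log p + Real.log (2 * Amax)) := h
    _ = c ^ r * ((p / Real.log p) * (∏ k, A k) * (W + Real.log p + Real.log (2 * Amax))) := by ring
    _ ≤ C₀ ^ r * ((p / Real.log p) * (∏ k, A k) * (W + Real.log p + Real.log (2 * Amax))) :=
        mul_le_mul_of_nonneg_right hcr hX
    _ = _ := by ring

/-- **The `2`-adic core on an arbitrary finite index type, in the odd-`p` currency** (from its
`Fin r` text: `ord₂(…)·log 2 ≤ ord₂(…) ≤ cʳ ∏A (W + log 2Amax) ≤ (max 1 |c|)ʳ (2/log 2) ∏A (W + log 2 + log 2Amax)`).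
[cite: Yu2007, Main Theorem (K = ℚ, ℘ = 2)] -/
theorem indepCore_of_padicCoreTwo {c : ℝ}
    (hTwo : ∀ (r : ℕ) (θ : Fin r → ℚ) (m : Fin r → ℤ) (A : Fin r → ℝ) (Amax W : ℝ),
      (∀ i, 3 ≤ padicValRat 2 (θ i - 1)) → (∀ μ : Fin r → ℤ, ∏ i, θ i ^ μ i = 1 → μ = 0) →
      (∀ i, Height.logHeight₁ (θ i) ≤ A i) → (∀ i, 1 ≤ A i) → (∀ i, A i ≤ Amax) →
      m ≠ 0 → (∀ i, Real.log (max 3 (|m i| : ℝ)) ≤ W) → 1 ≤ W →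
      (padicValRat 2 (∏ i, θ i ^ m i - 1) : ℝ) ≤ c ^ r * (∏ i, A i) * (W + Real.log (2 * Amax)))
    {C₀ : ℝ} (hcC : max 1 |c| ≤ C₀)
    (κ : Type) [Fintype κ] [DecidableEq κ] (θ : κ → ℚ) (n : κ → ℤ) (A : κ → ℝ) (Amax W : ℝ)
    (h8 : ∀ k, 3 ≤ padicValRat 2 (θ k - 1))
    (hind : ∀ μ : κ → ℤ, ∏ k, θ k ^ μ k = 1 → μ = 0)
    (hA : ∀ k, logHeight₁ (θ k) ≤ A k) (hA1 : ∀ k, 1 ≤ A k) (hAmax : ∀ k, A k ≤ Amax)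
    (hn : n ≠ 0) (hW : ∀ k, Real.log (max 3 (|n k| : ℝ)) ≤ W) (hW1 : 1 ≤ W) :
    (padicValRat 2 (∏ k, θ k ^ n k - 1) : ℝ) * Real.log (2 : ℕ) ≤
      C₀ ^ Fintype.card κ * (((2 : ℕ) : ℝ) / Real.log (2 : ℕ)) * (∏ k, A k) *
        (W + Real.log (2 : ℕ) + Real.log (2 * Amax)) := by
  set r := Fintype.card κ with hr
  set e : κ ≃ Fin r := Fintype.equivFin κ with he
  have hprod : ∀ (f : κ → ℤ), ∏ i : Fin r, θ (e.symm i) ^ f (e.symm i) = ∏ k, θ k ^ f k :=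
    fun f => Fintype.prod_equiv e.symm _ _ fun i => rfl
  have hprodA : ∏ i : Fin r, A (e.symm i) = ∏ k, A k := Fintype.prod_equiv e.symm _ _ fun i => rfl
  have hind' : ∀ μ : Fin r → ℤ, ∏ i, θ (e.symm i) ^ μ i = 1 → μ = 0 := by
    intro μ hμ
    have h1 : ∏ k, θ k ^ μ (e k) = 1 := by
      rw [← hprod (fun k => μ (e k))]
      simp only [Equiv.apply_symm_apply]
      exact hμ
    have h2 := hind (fun k => μ (e k)) h1
    funext i
    have := congrFun h2 (e.symm i)
    simpa using this
  have hn' : (fun i : Fin r => n (e.symm i)) ≠ 0 := by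
    intro h0; apply hn; funext k
    have := congrFun h0 (e k)
    simpa using this
  have h := hTwo r (fun i => θ (e.symm i)) (fun i => n (e.symm i)) (fun i => A (e.symm i))
    Amax W (fun i => h8 _) hind' (fun i => hA _) (fun i => hA1 _) (fun i => hAmax _) hn'
    (fun i => hW _) hW1
  rw [hprod n, hprodA] at h
  have hl2 : 0 < Real.log 2 := Real.log_pos one_lt_two
  have hl2' : Real.log 2 ≤ 1 := by linarith [Real.log_two_lt_d9]
  have h22 : ((2 : ℕ) : ℝ) = 2 := by norm_num
  rw [h22]
  have hAmax1 : 1 ≤ Amax := by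
    obtain ⟨k⟩ : Nonempty κ := by
      by_contra h0; rw [not_nonempty_iff] at h0; exact hn (funext fun k => isEmptyElim k)
    exact le_trans (hA1 k) (hAmax k)
  have hlogA : 0 ≤ Real.log (2 * Amax) := Real.log_nonneg (by linarith)
  have hPA : 0 ≤ ∏ k, A k := Finset.prod_nonneg fun k _ => le_trans zero_le_one (hA1 k)
  have hS0 : 0 ≤ W + Real.log (2 * Amax) := by linarith
  have hcr : c ^ r ≤ C₀ ^ r :=
    le_trans (le_abs_self _) (by
      rw [abs_pow]; exact pow_le_pow_left₀ (abs_nonneg c) ((le_max_right _ _).trans hcC) r)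
  have hM0 : 0 ≤ C₀ ^ r := pow_nonneg (le_trans zero_le_one ((le_max_left _ _).trans hcC)) r
  -- `ord₂ · log 2 ≤ max(ord₂, 0) ≤ …`
  have hup : (padicValRat 2 (∏ k, θ k ^ n k - 1) : ℝ) ≤
      C₀ ^ r * (∏ k, A k) * (W + Real.log (2 * Amax)) :=
    le_trans h (mul_le_mul_of_nonneg_right (mul_le_mul_of_nonneg_right hcr hPA) hS0)
  have hR0 : 0 ≤ C₀ ^ r * (∏ k, A k) * (W + Real.log (2 * Amax)) := by positivity
  have hdiv : (1 : ℝ) ≤ 2 / Real.log 2 := by rw [le_div_iff₀ hl2]; linarith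
  rcases le_or_gt 0 (padicValRat 2 (∏ k, θ k ^ n k - 1) : ℝ) with hv | hv
  · calc (padicValRat 2 (∏ k, θ k ^ n k - 1) : ℝ) * Real.log 2
        ≤ (padicValRat 2 (∏ k, θ k ^ n k - 1) : ℝ) * 1 := mul_le_mul_of_nonneg_left hl2' hv
      _ ≤ C₀ ^ r * (∏ k, A k) * (W + Real.log (2 * Amax)) := by rw [mul_one]; exact hup
      _ = (C₀ ^ r * (∏ k, A k)) * 1 * (W + Real.log (2 * Amax)) := by ring
      _ ≤ (C₀ ^ r * (∏ k, A k)) * (2 / Real.log 2) *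
            (W + Real.log 2 + Real.log (2 * Amax)) := by
          apply mul_le_mul (mul_le_mul_of_nonneg_left hdiv (by positivity)) (by linarith) hS0
          positivity
      _ = C₀ ^ r * (2 / Real.log 2) * (∏ k, A k) *
            (W + Real.log 2 + Real.log (2 * Amax)) := by ring
  · have h1 : (padicValRat 2 (∏ k, θ k ^ n k - 1) : ℝ) * Real.log 2 < 0 := mul_neg_of_neg_of_pos hv hl2
    have h2 : 0 ≤ C₀ ^ r * (2 / Real.log 2) * (∏ k, A k) *
        (W + Real.log 2 + Real.log (2 * Amax)) := by
      have : 0 ≤ W + Real.log 2 + Real.log (2 * Amax) := by linarith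
      positivity
    linarith


/-! ### The `p`-adic half from the two cores -/

/-- **The `p`-adic approximation bound over `ℚ` ("A1.L(p)") from the two Kummer-free `p`-adic
cores in shape form.** `padicApproximationBound_rat` (Pasten 2024 Thm 2.1 (ii), `d = 1`, `∃ K ≥ 1`)
follows from the odd-`p` core `hOdd` and the `2`-adic core `hTwo` (texts = the cell
`abc-stewartyu`'s internal Gen-3 statements `CoreOdd`/`CoreTwo` with the Kummer hypothesis deleted
and `C r := cʳ`; both are lower bounds for `p`-adic logarithmic forms in Yu's 2007 shape over `ℚ`
and are NOT proved here): reindexing (`indepCore_of_padicCoreOdd/Two`), elimination of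
multiplicative relations (`depCore_of_indepCore`), and Evertse–Győry §4.4.2 at `α = 1`
(`padicApproximationBound_rat_of_depCore`).
[cite: Pasten2024, Theorem 2.1 (ii) (d = 1)] [cite: EvertseGyory2015, Thm 4.2.1 (p. 68), proof pp. 80–81]
[cite: Yu2007, Main Theorem (K = ℚ)] -/
theorem padicApproximationBound_rat_of_padicCores
    (hOdd : ∃ c : ℝ, ∀ (p : ℕ), p.Prime → p ≠ 2 →
      ∀ (r : ℕ) (θ : Fin r → ℚ) (m : Fin r → ℤ) (A : Fin r → ℝ) (Amax W : ℝ),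
      (∀ i, θ i ≠ 0 ∧ padicValRat p (θ i) = 0) →
      (∀ μ : Fin r → ℤ, ∏ i, θ i ^ μ i = 1 → μ = 0) →
      (∀ i, Height.logHeight₁ (θ i) ≤ A i) → (∀ i, 1 ≤ A i) → (∀ i, A i ≤ Amax) →
      m ≠ 0 → (∀ i, Real.log (max 3 (|m i| : ℝ)) ≤ W) → 1 ≤ W →
      (padicValRat p (∏ i, θ i ^ m i - 1) : ℝ) * Real.log p ≤
        c ^ r * ((p : ℝ) / Real.log p) * (∏ i, A i) * (W + Real.log p + Real.log (2 * Amax)))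
    (hTwo : ∃ c : ℝ, ∀ (r : ℕ) (θ : Fin r → ℚ) (m : Fin r → ℤ) (A : Fin r → ℝ) (Amax W : ℝ),
      (∀ i, 3 ≤ padicValRat 2 (θ i - 1)) →
      (∀ μ : Fin r → ℤ, ∏ i, θ i ^ μ i = 1 → μ = 0) →
      (∀ i, Height.logHeight₁ (θ i) ≤ A i) → (∀ i, 1 ≤ A i) → (∀ i, A i ≤ Amax) →
      m ≠ 0 → (∀ i, Real.log (max 3 (|m i| : ℝ)) ≤ W) → 1 ≤ W →
      (padicValRat 2 (∏ i, θ i ^ m i - 1) : ℝ) ≤ c ^ r * (∏ i, A i) * (W + Real.log (2 * Amax))) :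
    padicApproximationBound_rat := by
  obtain ⟨c₁, h₁⟩ := hOdd
  obtain ⟨c₂, h₂⟩ := hTwo
  set C₀ : ℝ := max (max 1 |c₁|) (max 1 |c₂|) with hC₀
  have hC₀1 : 1 ≤ C₀ := le_trans (le_max_left _ _) (le_max_left _ _)
  have hl2 : 0 < Real.log 2 := Real.log_pos one_lt_two
  have hC : 1 ≤ (C₀ + 2) / Real.log 2 := by
    rw [le_div_iff₀ hl2]; linarith [Real.log_two_lt_d9]
  refine padicApproximationBound_rat_of_depCore hC fun p hp κ _ _ α b B hα hunit hα1 hα2 h8 hB hB3 hne => ?_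
  haveI := Fact.mk hp
  refine depCore_of_indepCore hC₀1 ?_ κ α b B hα hunit hα1 hα2 h8 hB hB3 hne
  intro κ' _ _ θ n A Amax W hθ h8' hind hA hA1 hAmax hn hW hW1
  by_cases hp2 : p = 2
  · subst hp2
    exact indepCore_of_padicCoreTwo h₂ (le_max_right _ _) κ' θ n A Amax W (h8' rfl) hind hA hA1
      hAmax hn hW hW1
  · exact indepCore_of_padicCoreOdd h₁ (le_max_left _ _) hp hp2 κ' θ n A Amax W hθ hind hA hA1
      hAmax hn hW hW1

end Literature.NumberTheory.DiophantineGeometry.Dioph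

end
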